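import Summits.QuantumFields.YangMills.Theorems.SwapVirialDeficitBlowUpGnomonicFollowerCoercivity
import Summits.QuantumFields.YangMills.Theorems.SwapVirialDeficitGnomonicTaylorLine
import HarnessLib

/-!
# (M2)(a) UNCONDITIONAL IN THE GNOMONIC FRAME: the quartic ray remainder `h4` of ✓`gnoFollower_raySecond_coercive[_twisted]` DISCHARGED by fcl-p3 g47's
# ✓`Gnomonic.taylor_four_gnoDeficit_line` — the follower block of the fibre Hessian at the reference point is `μ`-coercive, `μ = 1/(2304·L⁶·|Fol L|)`,
# over every near-flat gnomonic base point `(a, ε, η₀)` (hub `a ≠ 0`, follower signs `+`, follower coordinates `0`), every sector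
# (free-hands support of ⟨stmt-QuantumFields-24197⟩ `SwapVirialDeficit.SwapGluedStiffness`; brick W3, follower block, of LEAD ym-line-sfw-p2 g97's steep-window plan)

* ★ `gnoDeficit_followerLine_eq` — with `ξ_y := ((0,0),0,y)` (followers only) and `η₀.2.2 = 0`, `ε.2.2 ≡ true`: the line `s ↦ gnoDeficit z χ a ε (η₀ + s•ξ_y)` IS the follower ray
  `s ↦ F̂_z(C, gno⁺(s·y))` of the leader tuple `C = (blowUpPoint 1 (gnomonicPoint a ε η₀)).1`;
* ★★ `gnoFollower_ray_remainder_four` — `h4` with `B₄ = 63540000·L⁴` (`= 381240000L⁴/6`, letter sizes of `ξ_y` `≤ √(Σ|y_f|²)`), for ALL `y`;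
* ★★★ `gnoFollower_raySecond_coercive_gnomonic_twisted` ∕ `…_gnomonic` — for `C = (blowUpPoint 1 (gnomonicPoint a ε η₀)).1` with commutators and (signed) σ-relations `≤ s`,
  `0 < R ≤ 1`, `2·(300L⁴s²) ≤ μR²/2`, `2·(63540000L⁴)·R² ≤ μ/2`:  `μ·Σ_f|y_f|² ≤ (d²/dt²) F̂_z(C, gno⁺(t·y))|₀` for EVERY `y` — no jet hypothesis left; all
  thresholds polynomial in `L`, free of the hub angle.
What is NOT here: the leader-transverse block (hub stiffness floor), the Hessian-operator ∕ `EuclideanSpace` packaging for ✓`laplaceMethod_quantitative_fibred_of_taylor`.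

HONEST LABEL: composition of landed results; ⟨24197⟩ (window-uniform) ∕ ⟨24196⟩ ∕ ⟨24194⟩ ∕ ⟨24497⟩ OPEN; own crux ⟨22884⟩ OPEN (blocked-on ⟨19935⟩); no crux, rung of record or
summit is proved; the Yang–Mills mass gap is NOT proved; no summit is proved by a line.  THEOREMS ONLY (0 `def`, 0 `sorry`), standard axioms.
Width seat ym-line-sfw-p2-w3 g65 (cell ym-idea-1, free hands), `--supports stmt-QuantumFields-24197`.  References: [cite: Luscher1983, §2]; [folklore].
-/

set_option autoImplicit false

noncomputable section

open MeasureTheory Quaternion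
open scoped BigOperators Quaternion ContDiff
open Literature.MathematicalPhysics.QuantumFieldTheory hiding SU2
open Literature.MathematicalPhysics.QuantumLattice

namespace Summit.QuantumFields.YangMills.Theorems.SwapVirialDeficit.BlowUpRing

open Summit.QuantumFields.YangMills.Theorems.FemtoTransferGap
open Summit.QuantumFields.YangMills.Theorems.FemtoTransferGap.TT
open Summit.QuantumFields.YangMills.Theorems.VirialFluxGap.RingDeficit
open Summit.QuantumFields.YangMills.Theorems.SwapVirialDeficit.SwapRing
open Summit.QuantumFields.YangMills.Theorems.SwapVirialDeficit.Gnomonic (normSq3 normSq3_nonneg taylor_four_gnoDeficit_line)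
open Summit.QuantumFields.YangMills.Theorems.SwapVirialDeficit.BlowUp (dilateIm_one_apply)

variable {L : ℕ} [NeZero L]

/-! ## §1 The follower line of the gnomonic deficit is the follower ray of the chart deficit -/

/-- ★ With `ξ_y = ((0,0),0,y)`, follower coordinates `η₀.2.2 = 0` and follower signs `ε.2.2 ≡ true`:
`gnoDeficit z χ a ε (η₀ + s•ξ_y) = F̂_z(C, gno⁺(s·y))`, `C = (blowUpPoint 1 (gnomonicPoint a ε η₀)).1`. [folklore] -/
theorem gnoDeficit_followerLine_eq (z : Fin 3 → Bool) (χ : Site 3 L → SU2) (a : ℍ) (ε : GnoSign L) (η₀ : GnoCoord L)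
    (hε : ε.2.2 = fun _ => true) (hη : η₀.2.2 = 0) (y : Fol L → Fin 3 → ℝ) (s : ℝ) :
    gnoDeficit z χ a ε (η₀ + s • ((((0 : Fin 3 → ℝ), (0 : Fin 3 → ℝ)), ((0 : Fin 3 → ℝ), y)) : GnoCoord L)) =
      chartDeficit L z χ ((blowUpPoint 1 (gnomonicPoint a ε η₀)).1, fun f => quatToSU2 (gnoLetter true ((s • y) f))) := by
  unfold gnoDeficit
  congr 1
  refine Prod.ext ?_ ?_
  · simp only [blowUpPoint, gnomonicPoint, Prod.fst_add, Prod.snd_add, Prod.smul_fst, Prod.smul_snd, smul_zero, add_zero]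
  · funext f
    simp only [blowUpPoint, gnomonicPoint, Prod.snd_add, Prod.smul_snd, Pi.add_apply, Pi.smul_apply, hε, hη, Pi.zero_apply, zero_add,
      dilateIm_one_apply]

/-! ## §2 The quartic ray remainder from the line jets -/

/-- ★★ **`h4` discharged**: for `C = (blowUpPoint 1 (gnomonicPoint a ε η₀)).1` (`a ≠ 0`, follower signs `+`, follower coordinates `0`) and EVERY `y`,
`|F̂_z(C, gno⁺ y) − F̂_z(C, 1) − φ_y′(0) − φ_y″(0)/2 − φ_y‴(0)/6| ≤ 63540000·L⁴·(Σ_f|y_f|²)²` (✓`taylor_four_gnoDeficit_line` with letter size `S = √(Σ|y_f|²)`).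
[cite: Luscher1983, §2] -/
theorem gnoFollower_ray_remainder_four (z : Fin 3 → Bool) (χ : Site 3 L → SU2) {a : ℍ} (ha : a ≠ 0) (ε : GnoSign L) (η₀ : GnoCoord L)
    (hε : ε.2.2 = fun _ => true) (hη : η₀.2.2 = 0) (y : Fol L → Fin 3 → ℝ) :
    |chartDeficit L z χ ((blowUpPoint 1 (gnomonicPoint a ε η₀)).1, fun f => quatToSU2 (gnoLetter true (y f))) -
        chartDeficit L z χ ((blowUpPoint 1 (gnomonicPoint a ε η₀)).1, fun _ => 1) -
        deriv (fun t : ℝ => chartDeficit L z χ ((blowUpPoint 1 (gnomonicPoint a ε η₀)).1, fun f => quatToSU2 (gnoLetter true ((t • y) f)))) 0 -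
        iteratedDeriv 2 (fun t : ℝ => chartDeficit L z χ ((blowUpPoint 1 (gnomonicPoint a ε η₀)).1, fun f => quatToSU2 (gnoLetter true ((t • y) f)))) 0 / 2 -
        iteratedDeriv 3 (fun t : ℝ => chartDeficit L z χ ((blowUpPoint 1 (gnomonicPoint a ε η₀)).1, fun f => quatToSU2 (gnoLetter true ((t • y) f)))) 0 / 6| ≤
      63540000 * (L : ℝ) ^ 4 * (∑ f, normSq3 (y f)) ^ 2 := by
  set ξ : GnoCoord L := (((0 : Fin 3 → ℝ), (0 : Fin 3 → ℝ)), ((0 : Fin 3 → ℝ), y)) with hξ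
  set S : ℝ := Real.sqrt (∑ f, normSq3 (y f)) with hS
  have hN0 : 0 ≤ ∑ f, normSq3 (y f) := Finset.sum_nonneg fun f _ => normSq3_nonneg (y f)
  have hS0 : 0 ≤ S := Real.sqrt_nonneg _
  have h0 : Real.sqrt (∑ k : Fin 3, (0 : Fin 3 → ℝ) k ^ 2) ≤ S := by simp [hS0]
  have hf : ∀ i, Real.sqrt (∑ k, ξ.2.2 i k ^ 2) ≤ S := fun i => by
    apply Real.sqrt_le_sqrt
    exact Finset.single_le_sum (fun g _ => normSq3_nonneg (y g)) (Finset.mem_univ i)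
  obtain ⟨-, -, h4⟩ := taylor_four_gnoDeficit_line z χ ha ε η₀ ξ hS0 h0 h0 h0 hf
  have hline : (fun s : ℝ => gnoDeficit z χ a ε (η₀ + s • ξ)) =
      fun t : ℝ => chartDeficit L z χ ((blowUpPoint 1 (gnomonicPoint a ε η₀)).1, fun f => quatToSU2 (gnoLetter true ((t • y) f))) :=
    funext fun s => gnoDeficit_followerLine_eq z χ a ε η₀ hε hη y s
  have h1 : gnoDeficit z χ a ε (η₀ + ξ) = chartDeficit L z χ ((blowUpPoint 1 (gnomonicPoint a ε η₀)).1, fun f => quatToSU2 (gnoLetter true (y f))) := by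
    have h := gnoDeficit_followerLine_eq z χ a ε η₀ hε hη y 1
    rw [one_smul, one_smul] at h; exact h
  have h0' : gnoDeficit z χ a ε η₀ = chartDeficit L z χ ((blowUpPoint 1 (gnomonicPoint a ε η₀)).1, fun _ => 1) := by
    have h := gnoDeficit_followerLine_eq z χ a ε η₀ hε hη y 0
    rw [zero_smul, add_zero, zero_smul] at h
    rw [h]; simp only [Pi.zero_apply, gnoPlus_zero]
  rw [hline, h1, h0'] at h4
  have hS4 : S ^ 4 = (∑ f, normSq3 (y f)) ^ 2 := by
    rw [show (4 : ℕ) = 2 * 2 from rfl, pow_mul, hS, Real.sq_sqrt hN0]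
  calc _ ≤ 381240000 * (L : ℝ) ^ 4 * S ^ 4 / 6 := h4
    _ = 63540000 * (L : ℝ) ^ 4 * (∑ f, normSq3 (y f)) ^ 2 := by rw [hS4]; ring

/-! ## §3 (M2)(a), unconditional -/

/-- ★★★ **(M2)(a) UNCONDITIONAL, EVERY SECTOR**: hub `a ≠ 0`, follower signs `+`, follower coordinates `0` at the base point `η₀`; the leader tuple
`C = (blowUpPoint 1 (gnomonicPoint a ε η₀)).1` has commutators and SIGNED σ-relations `≤ s`; `0 < R ≤ 1` with `2·(300L⁴s²) ≤ μR²/2` and `2·(63540000L⁴)·R² ≤ μ/2`,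
`μ = 1/(2304·L⁶·|Fol L|)`.  Then for EVERY `y : Fol L → ℝ³`:  `μ·Σ_f|y_f|² ≤ (d²/dt²) F̂_z(C, gno⁺(t·y))|₀`. [cite: Luscher1983, §2] -/
theorem gnoFollower_raySecond_coercive_gnomonic_twisted (z : Fin 3 → Bool) {a : ℍ} (ha : a ≠ 0) (ε : GnoSign L) (η₀ : GnoCoord L)
    (hε : ε.2.2 = fun _ => true) (hη : η₀.2.2 = 0) {s R : ℝ} (hs : 0 ≤ s) (hR : 0 < R) (hR1 : R ≤ 1)
    (hCC : ∀ μ ν : Fin 3, frobNorm ((((blowUpPoint 1 (gnomonicPoint a ε η₀)).1 (Fin.castSucc μ) * (blowUpPoint 1 (gnomonicPoint a ε η₀)).1 (Fin.castSucc ν) : SU2) :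
        Matrix (Fin 2) (Fin 2) ℂ) - (((blowUpPoint 1 (gnomonicPoint a ε η₀)).1 (Fin.castSucc ν) * (blowUpPoint 1 (gnomonicPoint a ε η₀)).1 (Fin.castSucc μ) : SU2) :
        Matrix (Fin 2) (Fin 2) ℂ)) ≤ s)
    (hσ : ∀ μ : Fin 3, frobNorm ((((blowUpPoint 1 (gnomonicPoint a ε η₀)).1 (Fin.last 3) *
        (blowUpPoint 1 (gnomonicPoint a ε η₀)).1 (Fin.castSucc (Equiv.swap (0 : Fin 3) 1 μ)) : SU2) : Matrix (Fin 2) (Fin 2) ℂ) -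
        ((centreElem (z μ) * (blowUpPoint 1 (gnomonicPoint a ε η₀)).1 (Fin.castSucc μ) * (blowUpPoint 1 (gnomonicPoint a ε η₀)).1 (Fin.last 3) : SU2) :
        Matrix (Fin 2) (Fin 2) ℂ)) ≤ s)
    (hsmall₁ : 2 * (300 * (L : ℝ) ^ 4 * s ^ 2) ≤ (2304 * (L : ℝ) ^ 6 * (Fintype.card (Fol L) : ℝ))⁻¹ * R ^ 2 / 2)
    (hsmall₂ : 2 * (63540000 * (L : ℝ) ^ 4) * R ^ 2 ≤ (2304 * (L : ℝ) ^ 6 * (Fintype.card (Fol L) : ℝ))⁻¹ / 2)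
    (y : Fol L → Fin 3 → ℝ) :
    (2304 * (L : ℝ) ^ 6 * (Fintype.card (Fol L) : ℝ))⁻¹ * ∑ f, normSq3 (y f) ≤
      iteratedDeriv 2 (fun t : ℝ => chartDeficit L z
        (fun x => centreElem (Bool.xor (z 0 && decide (x 0 ≠ 0)) (Bool.xor (z 1 && decide (x 1 ≠ 0)) (z 2 && decide (x 2 ≠ 0)))))
          ((blowUpPoint 1 (gnomonicPoint a ε η₀)).1, fun f => quatToSU2 (gnoLetter true ((t • y) f)))) 0 :=
  gnoFollower_raySecond_coercive_twisted (L := L) z (blowUpPoint 1 (gnomonicPoint a ε η₀)).1 (B₄ := 63540000 * (L : ℝ) ^ 4) hs hR hR1 hCC hσ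
    (fun y' _ => gnoFollower_ray_remainder_four z _ ha ε η₀ hε hη y') hsmall₁ hsmall₂ y

/-- ★★★ **(M2)(a) UNCONDITIONAL, PRINCIPAL SECTOR** (`χ ≡ 1`, unsigned σ-relations). [cite: Luscher1983, §2] -/
theorem gnoFollower_raySecond_coercive_gnomonic {a : ℍ} (ha : a ≠ 0) (ε : GnoSign L) (η₀ : GnoCoord L)
    (hε : ε.2.2 = fun _ => true) (hη : η₀.2.2 = 0) {s R : ℝ} (hs : 0 ≤ s) (hR : 0 < R) (hR1 : R ≤ 1)
    (hCC : ∀ μ ν : Fin 3, frobNorm ((((blowUpPoint 1 (gnomonicPoint a ε η₀)).1 (Fin.castSucc μ) * (blowUpPoint 1 (gnomonicPoint a ε η₀)).1 (Fin.castSucc ν) : SU2) :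
        Matrix (Fin 2) (Fin 2) ℂ) - (((blowUpPoint 1 (gnomonicPoint a ε η₀)).1 (Fin.castSucc ν) * (blowUpPoint 1 (gnomonicPoint a ε η₀)).1 (Fin.castSucc μ) : SU2) :
        Matrix (Fin 2) (Fin 2) ℂ)) ≤ s)
    (hσ : ∀ μ : Fin 3, frobNorm ((((blowUpPoint 1 (gnomonicPoint a ε η₀)).1 (Fin.last 3) *
        (blowUpPoint 1 (gnomonicPoint a ε η₀)).1 (Fin.castSucc (Equiv.swap (0 : Fin 3) 1 μ)) : SU2) : Matrix (Fin 2) (Fin 2) ℂ) -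
        (((blowUpPoint 1 (gnomonicPoint a ε η₀)).1 (Fin.castSucc μ) * (blowUpPoint 1 (gnomonicPoint a ε η₀)).1 (Fin.last 3) : SU2) : Matrix (Fin 2) (Fin 2) ℂ)) ≤ s)
    (hsmall₁ : 2 * (300 * (L : ℝ) ^ 4 * s ^ 2) ≤ (2304 * (L : ℝ) ^ 6 * (Fintype.card (Fol L) : ℝ))⁻¹ * R ^ 2 / 2)
    (hsmall₂ : 2 * (63540000 * (L : ℝ) ^ 4) * R ^ 2 ≤ (2304 * (L : ℝ) ^ 6 * (Fintype.card (Fol L) : ℝ))⁻¹ / 2)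
    (y : Fol L → Fin 3 → ℝ) :
    (2304 * (L : ℝ) ^ 6 * (Fintype.card (Fol L) : ℝ))⁻¹ * ∑ f, normSq3 (y f) ≤
      iteratedDeriv 2 (fun t : ℝ => chartDeficit L (fun _ => false) (fun _ => 1)
        ((blowUpPoint 1 (gnomonicPoint a ε η₀)).1, fun f => quatToSU2 (gnoLetter true ((t • y) f)))) 0 :=
  gnoFollower_raySecond_coercive (L := L) (blowUpPoint 1 (gnomonicPoint a ε η₀)).1 (B₄ := 63540000 * (L : ℝ) ^ 4) hs hR hR1 hCC hσ
    (fun y' _ => gnoFollower_ray_remainder_four (fun _ => false) _ ha ε η₀ hε hη y') hsmall₁ hsmall₂ y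

end Summit.QuantumFields.YangMills.Theorems.SwapVirialDeficit.BlowUpRing

end
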